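import Summits.AtomisticToContinuum.BoseEinsteinCondensation.Theorems.BECRichardsonGaudinBeliaevDeformationBoundComparisonOfCondensation
import Summits.AtomisticToContinuum.BoseEinsteinCondensation.Theorems.BECRichardsonGaudinBeliaevDeformationBoundJastrowDepletion
import Summits.AtomisticToContinuum.BoseEinsteinCondensation.Theorems.BECRichardsonGaudinBeliaevDeformationBoundJastrowEnergy
import Summits.AtomisticToContinuum.BoseEinsteinCondensation.Theorems.BECRichardsonGaudinBeliaevDeformationBoundCondensedTrialState
import Summits.AtomisticToContinuum.BoseEinsteinCondensation.Theorems.BECRichardsonGaudinBeliaevDeformationBoundPenalisedCondensation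
import Summits.AtomisticToContinuum.BoseEinsteinCondensation.Theorems.BECFeynmanVortexAreaFreeGasCondensation

/-!
# Route `BECRichardsonGaudin`, crux `BeliaevDeformationBound` (stmt-AtomisticToContinuum-14804):
# leg B ASSEMBLED — the gapped comparison `Cmp(E_pen, E_anc; ε)` is a theorem, and the crux holds
# conditionally on the infrared leg A alone

Line `registered` (`Cruxes/BeliaevDeformationBound/Lines/birth.lean`, lead reshape r1). With the five
B-side stubs landed (`stub_jastrowDepletion`, `stub_jastrowEnergy`, `stub_condensedTrialState`,
`stub_penalisedCondensation`, `stub_comparisonOfCondensation`), this file discharges leg B of the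
skeleton for real:

* `gappedAnchorComparison` — for every soft repulsive finite-range `v`, `Λ > 0`, `ε > 0`, at small `ρ`,
  eventually in `N = n + 2`: every `δ`-near-minimiser of the SHIFTED gas
  `E_pen = periodicEnergy v + 2ργ(N − n₀)` is, up to `εN`, at least as condensed as some
  `δ'`-near-minimiser of Richardson's matched anchor functional (verbatim the crux's `E`). Case
  `∫v = 0`: both functionals are the free energy (`periodicEnergy_eq_zero_pot`). Case `∫v ≠ 0`:
  complete condensation of the shifted gas (B2 ∘ B1c ∘ (B1a, B1b): Jastrow trial state + LY98) and
  the sandwich B3.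
* `beliaevDeformationBound_of_shiftRemoval` — the crux BY NAME from the infrared leg A alone
  (`Cmp(E_gas, E_pen; ε)`, stated explicitly; = registered stub `stub_shiftRemoval`, in substance
  complete BEC of the soft periodic gas — the open problem), by transitivity with `ε/2 + ε/2`.

So the crux is now CLOSED MODULO `stub_shiftRemoval`, and (skeleton §4, kernel-checked)
`stub_shiftRemoval ⇔` complete condensation of the soft gas, given the landed B2/B3.

References: LSSY2005 Thm 2.2, Thm 2.4, App. C, Ch. 5 (5.17); the line card `Lines/birth.md`.
-/

noncomputable section

namespace Summit.AtomisticToContinuum.BoseEinsteinCondensation.Theorems.BeliaevDeformationBound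

open scoped ENNReal
open MeasureTheory Filter
open Literature.MathematicalPhysics.QuantumManyBody.BoseGas

/-- **Leg B: the gapped comparison `Cmp(E_pen, E_anc; ε)`** (statement B of the line, verbatim).
[cite: LSSY2005, Thm. 2.2 (2.14), Thm. 2.4 (2.35), Ch. 5 (5.17)] -/
theorem gappedAnchorComparison :
  ∀ (v : ℝ → ENNReal) (Λ ε : ℝ), IsRepulsiveFiniteRange v → (∫⁻ x : EuclideanSpace ℝ (Fin 3), v ‖x‖) ≠ ⊤ →
    0 < Λ → 0 < ε → ∃ ρ₀ : ℝ, 0 < ρ₀ ∧ ∀ ρ : ℝ, 0 < ρ → ρ < ρ₀ → ∀ᶠ n : ℕ in Filter.atTop,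
      let N : ℕ := n + 2
      let L : ℝ := sideLength ρ N
      let γ : ℝ := (∫⁻ x : EuclideanSpace ℝ (Fin 3), v ‖x‖).toReal
      let M : ℕ := ⌊Λ * L / (2 * Real.pi)⌋₊
      let w : EuclideanSpace ℝ (Fin 3) → EuclideanSpace ℝ (Fin 3) → ℂ := fun x y =>
        ∑ m ∈ Fintype.piFinset (fun _ : Fin 3 => Finset.Icc (-(M : ℤ)) M),
          Complex.exp (2 * Real.pi * Complex.I / L * ∑ j : Fin 3, (m j : ℂ) * ((x j - y j : ℝ) : ℂ))
      let E : PeriodicTrialState N L → ENNReal := fun Φ =>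
        periodicEnergy 0 Φ + ENNReal.ofReal (2 * ρ * γ) * ((N : ENNReal) - condensateOccupation N L Φ.ψ) +
          ENNReal.ofReal (γ / L ^ 9 * ((N : ℝ) * (N - 1) / 2)) *
            ∫⁻ Y in cellN n L, (‖∫ x in cell L, ∫ y in cell L,
              (starRingEnd ℂ) (w x y) * Φ.ψ (Matrix.vecCons x (Matrix.vecCons y Y))‖₊ : ENNReal) ^ 2
      let Epen : PeriodicTrialState N L → ENNReal := fun Φ =>
        periodicEnergy v Φ + ENNReal.ofReal (2 * ρ * γ) * ((N : ENNReal) - condensateOccupation N L Φ.ψ)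
      ∀ δ' : ENNReal, 0 < δ' → ∃ δ : ENNReal, 0 < δ ∧ ∀ Ψ : PeriodicTrialState N L,
        Epen Ψ ≤ (⨅ Ψ', Epen Ψ') + δ →
          ∃ Φ : PeriodicTrialState N L, E Φ ≤ (⨅ Φ', E Φ') + δ' ∧
            condensateOccupation N L Φ.ψ ≤ condensateOccupation N L Ψ.ψ + ENNReal.ofReal (ε * N) := by
  intro v Λ ε hv hint _hΛ hε
  by_cases h0 : (∫⁻ x : Space, v ‖x‖) = 0
  · -- the a.e.-free gas: both functionals are the free energy
    refine ⟨1, one_pos, fun ρ _hρ _ => Filter.Eventually.of_forall fun n => ?_⟩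
    dsimp only
    intro δ' hδ'
    refine ⟨δ', hδ', fun Ψ hΨ => ⟨Ψ, ?_, le_self_add⟩⟩
    have hfree : ∀ Φ : PeriodicTrialState (n + 2) (sideLength ρ (n + 2)),
        periodicEnergy v Φ = periodicEnergy 0 Φ := fun Φ =>
      Summit.AtomisticToContinuum.BoseEinsteinCondensation.Theorems.periodicEnergy_eq_zero_pot hv.1 h0 Φ
    simp only [h0, ENNReal.toReal_zero, mul_zero, zero_mul, zero_div, ENNReal.ofReal_zero, add_zero,
      hfree] at hΨ ⊢
    exact hΨ
  · -- the interacting soft gas: sandwich through complete condensation of the shifted gas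
    obtain ⟨ρ₀, hρ₀, H⟩ := stub_penalisedCondensation
      (stub_condensedTrialState stub_jastrowDepletion stub_jastrowEnergy) v hv hint h0 ε hε
    refine ⟨ρ₀, hρ₀, fun ρ hρ hρlt => ?_⟩
    filter_upwards [H ρ hρ hρlt] with n hn
    dsimp only
    have hL : 0 < sideLength ρ (n + 2) := by
      unfold sideLength
      exact Real.rpow_pos_of_pos (div_pos (by exact_mod_cast Nat.succ_pos _) hρ) _
    exact stub_comparisonOfCondensation (n + 2) (sideLength ρ (n + 2)) ε hL _ _ hn

/-- **The crux holds conditionally on the infrared leg alone**: `Cmp(E_gas, E_pen; ε)` (the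
registered stub `stub_shiftRemoval`, stated explicitly; in substance complete BEC of the soft periodic
gas in the thermodynamic limit — open) implies `BeliaevDeformationBound` by name, by transitivity of
the comparison through the shifted gas (`gappedAnchorComparison`) with `ε/2 + ε/2`, the
`δ`-bookkeeping run backwards, `ρ₀ = min ρ₁ ρ₂` and the intersection of the eventually-sets.
[cite: LSSY2005, Ch. 5 (5.17)] -/
theorem beliaevDeformationBound_of_shiftRemoval :
  (∀ (v : ℝ → ENNReal) (ε : ℝ), IsRepulsiveFiniteRange v → (∫⁻ x : EuclideanSpace ℝ (Fin 3), v ‖x‖) ≠ ⊤ →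
    0 < ε → ∃ ρ₀ : ℝ, 0 < ρ₀ ∧ ∀ ρ : ℝ, 0 < ρ → ρ < ρ₀ → ∀ᶠ n : ℕ in Filter.atTop,
      ∀ δ' : ENNReal, 0 < δ' → ∃ δ : ENNReal, 0 < δ ∧ ∀ Ψ : PeriodicTrialState (n + 2) (sideLength ρ (n + 2)),
        periodicEnergy v Ψ ≤ periodicGroundStateEnergy v (n + 2) (sideLength ρ (n + 2)) + δ →
          ∃ Φ : PeriodicTrialState (n + 2) (sideLength ρ (n + 2)),
            periodicEnergy v Φ + ENNReal.ofReal (2 * ρ * (∫⁻ x : EuclideanSpace ℝ (Fin 3), v ‖x‖).toReal) *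
                (((n + 2 : ℕ) : ENNReal) - condensateOccupation (n + 2) (sideLength ρ (n + 2)) Φ.ψ) ≤
              (⨅ Φ' : PeriodicTrialState (n + 2) (sideLength ρ (n + 2)),
                (periodicEnergy v Φ' + ENNReal.ofReal (2 * ρ * (∫⁻ x : EuclideanSpace ℝ (Fin 3), v ‖x‖).toReal) *
                  (((n + 2 : ℕ) : ENNReal) - condensateOccupation (n + 2) (sideLength ρ (n + 2)) Φ'.ψ))) + δ' ∧
            condensateOccupation (n + 2) (sideLength ρ (n + 2)) Φ.ψ ≤
              condensateOccupation (n + 2) (sideLength ρ (n + 2)) Ψ.ψ + ENNReal.ofReal (ε * ((n + 2 : ℕ) : ℝ))) →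
  Summit.AtomisticToContinuum.BoseEinsteinCondensation.Theses.BECRichardsonGaudin.BeliaevDeformationBound := by
  intro hA
  have hB := gappedAnchorComparison
  intro v Λ ε hv hint hΛ hε
  obtain ⟨ρ₁, hρ₁, h₁⟩ := hA v (ε / 2) hv hint (half_pos hε)
  obtain ⟨ρ₂, hρ₂, h₂⟩ := hB v Λ (ε / 2) hv hint hΛ (half_pos hε)
  refine ⟨min ρ₁ ρ₂, lt_min hρ₁ hρ₂, fun ρ hρ hρlt => ?_⟩
  filter_upwards [h₁ ρ hρ (hρlt.trans_le (min_le_left _ _)),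
    h₂ ρ hρ (hρlt.trans_le (min_le_right _ _))] with n hn₁ hn₂
  dsimp only at hn₁ hn₂ ⊢
  intro δ' hδ'
  obtain ⟨δ₁, hδ₁, H₂⟩ := hn₂ δ' hδ'
  obtain ⟨δ, hδ, H₁⟩ := hn₁ δ₁ hδ₁
  refine ⟨δ, hδ, fun Ψ hΨ => ?_⟩
  obtain ⟨Φ₁, hΦ₁E, hΦ₁n⟩ := H₁ Ψ hΨ
  obtain ⟨Φ, hΦE, hΦn⟩ := H₂ Φ₁ hΦ₁E
  refine ⟨Φ, hΦE, ?_⟩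
  have hε2 : 0 ≤ ε / 2 * ((n + 2 : ℕ) : ℝ) := mul_nonneg (half_pos hε).le (Nat.cast_nonneg _)
  have hsum : ENNReal.ofReal (ε / 2 * ((n + 2 : ℕ) : ℝ)) + ENNReal.ofReal (ε / 2 * ((n + 2 : ℕ) : ℝ)) =
      ENNReal.ofReal (ε * ((n + 2 : ℕ) : ℝ)) := by
    rw [← ENNReal.ofReal_add hε2 hε2, ← add_mul, add_halves]
  calc condensateOccupation (n + 2) (sideLength ρ (n + 2)) Φ.ψ
      ≤ condensateOccupation (n + 2) (sideLength ρ (n + 2)) Φ₁.ψ +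
          ENNReal.ofReal (ε / 2 * ((n + 2 : ℕ) : ℝ)) := hΦn
    _ ≤ condensateOccupation (n + 2) (sideLength ρ (n + 2)) Ψ.ψ +
          ENNReal.ofReal (ε / 2 * ((n + 2 : ℕ) : ℝ)) + ENNReal.ofReal (ε / 2 * ((n + 2 : ℕ) : ℝ)) :=
        add_le_add hΦ₁n le_rfl
    _ = condensateOccupation (n + 2) (sideLength ρ (n + 2)) Ψ.ψ +
          ENNReal.ofReal (ε * ((n + 2 : ℕ) : ℝ)) := by
        rw [add_assoc, hsum]

end Summit.AtomisticToContinuum.BoseEinsteinCondensation.Theorems.BeliaevDeformationBound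

end
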